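import Summits.HodgeConjecture.CorCM.MultiFieldWeilUnitsMenuImprimitiveShapes
import Summits.HodgeConjecture.CorCM.MultiFieldWeilForeignBlocks
import HarnessLib

/-!
# MULTI-FIELD WEIL ENGINE — THE NET THEOREM OVER SEVERAL IMAGINARY QUADRATIC FIELDS: for each label `c` an imaginary quadratic field `k_c`, its CM elliptic curve `E_c` and
# its units menu by shapes with imprimitive quartic singles (G6); the blocks pairwise FOREIGN (complex conjugation fixes the intersection of each block's closure compositum with
# the others') ⟹ the Hodge conjecture for every product of copies of all these varieties, given only Markman's fourfold and hyperbolic-sixfold theorems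

Cell `pub-hodgecm2` (COR-CM), seat b30 gen 40 (2026-08-26); count-neutral own lane MULTI-FIELD WEIL ENGINE (stem `MultiFieldWeil*`), the SEVERAL-`k` dress of
`CorCM/MultiFieldWeilUnitsMenuImprimitiveShapes.lean` (G6, `hodgeConjectureFor_biproduct_sigma_imprimitive_of_shapes`) by gen 31's UNCONDITIONAL gluing of foreign blocks
(`CorCM/MultiFieldWeilForeignBlocks.lean`, `hodgeConjectureFor_prod_of_foreign_blocks_of_conj_apply_eq`).  Theorems only; no definition, no named fact, no `sorry`.  HONEST FRAMING:
conditional ONLY on the two displayed Markman binders; `HC_CM` is NOT proved and not asserted.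

**`hodgeConjectureFor_biproduct_sigma_blocks_of_shapes`.**  Labels `c : C` (finite, non-empty); for each `c`: an imaginary quadratic field `kc c` with `τc c` and its CM elliptic
curve `Ec c ⊨ (kc c; {τc c})`; finitely many CM fields `KJ c j ⊇ iK c j (kc c)` (`j : J c`), flagged (`tJ c j`) or not when octic, with structures `B c j t ⊨ (KJ c j; Ψ c j t)`,
`t : Fin (cJ c j)`, satisfying — label by label — EXACTLY the hypotheses of G6 (menu counts, sextic simple, non-isogenous within a field, shapes `≤ 2 ∕ ≤ 3 + hsep ∕ ≤ 4 +
(H1)(H2)`, unflagged octic singles with `hone` and `hdisj`, degree-`24` ∕ `40` pairs, `Hom = ∅`, values outside); and FOREIGNNESS: for every `c`, complex conjugation fixes every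
complex number lying both in `L(kc c) ⊔ ⨆_j L(KJ c j)` and in `⨆_{c' ≠ c} (L(kc c') ⊔ ⨆_j L(KJ c' j))` (`L(·) = normalClosure ℚ · ℂ`; e.g. the two composita meet in `ℚ` or in a
field of odd degree).  THEN the Hodge conjecture holds for `⨁_l X_l`, every `X_l ∈ ⋃_c ({Ec c} ∪ {B c j t})` (any multiplicities, any order; members indexed by
`Σ c, Option (Σ j, Fin (cJ c j))`), GIVEN ONLY Markman's two theorems; `…_of_inf_eq_bot` (composita meeting in `ℚ`); dominated ∕ isogeny-closed form `hodgeConjectureFor_of_avDominatedBy_biproduct_of_isIsogenous_blocks_of_shapes` (v2).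
PROOF: the uniform family `X ⟨c, o⟩ = o.elim (Ec c) (B c ··)` over the fields `o.elim (kc c) (KJ c ·)` (instances by `Option.rec`), labels `Sigma.fst`; inside a label the
product is G6's `⨁_l (κ l).elim (Ec c) (B c ··)` with `κ l = (hρc l) ▸ (ρ l).2`; the foreignness hypothesis bounds the `Σ`-indexed composita by the displayed ones.

[cite: Markman2025SurveySecant, Thm. 1.2] [cite: Markman2025SecantWeil, Thm 1.5.1] [cite: Lang2002, VI §1 Thm. 1.14 and V §2 Thm. 2.8] [cite: Pohlmann1968, Thm 1]
[cite: Milne2020HodgeClassesAV, 1.2 (a) and Thm. 1] [cite: Shimura1998, §6.1 Corollary of Theorem 2, §8.2 Prop. 26, §8.4, §18.2 Lemma (i)] [cite: Deligne1982HodgeCycles, §5 (b)]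
[cite: DixonMortimer1996, §1.4 Ex. 1.4.1–1.4.2; §1.6, Thm. 1.6A; §2.1; §3.3, Thm. 3.3A] [cite: Dodson1984, §1.1 Imprimitivity Theorem and §5.1.2 Theorem] [cite: MumfordAV1970, §19]

## References
* [Markman2025SurveySecant] E. Markman, arXiv:2509.23403, Thm. 1.2.  [Markman2025SecantWeil] E. Markman, Cycles on abelian 2n-folds of Weil type from secant sheaves on abelian
  n-folds, Thm 1.5.1.  [Lang2002] S. Lang, *Algebra*, GTM 211, V §2 Thm. 2.8, VI §1 Thm. 1.14.  [Pohlmann1968] H. Pohlmann, Ann. of Math. 88 (1968), Thm 1.  [Milne2020HodgeClassesAV]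
  J. S. Milne, Hodge classes on abelian varieties (2020), §1.  [Shimura1998] G. Shimura, *Abelian varieties with complex multiplication and modular functions*, §6.1, §8.2, §8.4,
  §18.2.  [Deligne1982HodgeCycles] P. Deligne, LNM 900, §5 (b).  [DixonMortimer1996] J. D. Dixon, B. Mortimer, *Permutation Groups*, GTM 163.  [Dodson1984] B. Dodson, Trans.
  AMS 283 (1984).  [MumfordAV1970] D. Mumford, *Abelian Varieties*, §19.
-/

noncomputable section

open CategoryTheory CategoryTheory.Limits NumberField IntermediateField

namespace Summit.HodgeConjecture.CorCM.MultiFieldWeil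

open Finset
open Literature.AlgebraicGeometry Literature.AlgebraicGeometry.Motives Literature.AlgebraicGeometry.HodgeTheory
open Literature.AlgebraicGeometry.ComplexMultiplication (IsCMTypeRealisation)
open Literature.AlgebraicTopology.SingularHomology
open Literature.NumberTheory.ComplexMultiplication

open scoped Classical

section Blocks

variable {C : Type} [Fintype C] [Nonempty C] {kc : C → Type} [fk : ∀ c, Field (kc c)] [nk : ∀ c, NumberField (kc c)] [ck : ∀ c, IsCMField (kc c)] {τc : ∀ c, kc c →+* ℂ}
  {Ec : C → AbelianVariety ℂ} {Φ₀ : ∀ c, CMType (kc c)} {ιE : ∀ c, 𝓞 (kc c) →+* End (Ec c)} {θE : ∀ c, kc c →+* Module.End ℂ (complexBetti (Ec c).X 1)}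
  {J : C → Type} [∀ c, Fintype (J c)] {KJ : ∀ c, J c → Type} [fK : ∀ c j, Field (KJ c j)] [nK : ∀ c j, NumberField (KJ c j)] [cK : ∀ c j, IsCMField (KJ c j)]
  {cJ : ∀ c, J c → ℕ} {B : ∀ c (j : J c), Fin (cJ c j) → AbelianVariety ℂ} {Ψ : ∀ c (j : J c), Fin (cJ c j) → CMType (KJ c j)}
  {ιB : ∀ c (j : J c) (t : Fin (cJ c j)), 𝓞 (KJ c j) →+* End (B c j t)} {θB : ∀ c (j : J c) (t : Fin (cJ c j)), KJ c j →+* Module.End ℂ (complexBetti (B c j t).X 1)}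

/-- **THE NET THEOREM OVER SEVERAL IMAGINARY QUADRATIC FIELDS (FOREIGN SHAPE BLOCKS) — GIVEN ONLY MARKMAN'S FOURFOLD AND HYPERBOLIC-SIXFOLD THEOREMS.**  See the module
docstring.  `HC_CM` is NOT asserted. [cite: Markman2025SurveySecant, Thm. 1.2] [cite: Markman2025SecantWeil, Thm 1.5.1] [cite: Lang2002, VI §1 Thm. 1.14 and V §2 Thm. 2.8]
[cite: Pohlmann1968, Thm 1] [cite: Shimura1998, §6.1 Corollary of Theorem 2, §8.2 Prop. 26, §18.2] [cite: Deligne1982HodgeCycles, §5 (b)]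
[cite: DixonMortimer1996, §1.4 Ex. 1.4.1–1.4.2; §1.6, Thm. 1.6A; §2.1] [cite: Dodson1984, §1.1 Imprimitivity Theorem and §5.1.2 Theorem] -/
theorem hodgeConjectureFor_biproduct_sigma_blocks_of_shapes (hW4 : Markman2025_weilClasses_algebraic_abelianFourfold)
    (hM6 : Markman2025_weilClasses_algebraic_hyperbolicSixfold) (h2 : ∀ c, Module.finrank ℚ (kc c) = 2) (iK : ∀ c (j : J c), kc c →+* KJ c j)
    (nJ : ∀ c, J c → ℕ)
    (hdeg : ∀ c j, Module.finrank ℚ (KJ c j) = 2 * nJ c j) (hB : ∀ c j t, IsCMTypeRealisation (Ψ c j t) (B c j t) (ιB c j t) (θB c j t))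
    (hE : ∀ c, IsCMTypeRealisation (Φ₀ c) (Ec c) (ιE c) (θE c)) (hΦ₀ : ∀ c (σ : kc c →+* ℂ), σ ∈ (Φ₀ c).1 ↔ σ = τc c) (tJ : ∀ c, J c → Prop)
    (hS : ∀ c j, nJ c j = 3 → ∀ t, (B c j t).IsSimple)
    (hcnt : ∀ c j t, (nJ c j = 3 ∧ (Finset.univ.filter fun s : KJ c j →+* ℂ => s.comp (iK c j) = τc c ∧ s ∈ (Ψ c j t).1).card = 1) ∨
      (nJ c j = 4 ∧ (Finset.univ.filter fun s : KJ c j →+* ℂ => s.comp (iK c j) = τc c ∧ s ∈ (Ψ c j t).1).card = 1) ∨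
      (nJ c j = 4 ∧ (Finset.univ.filter fun s : KJ c j →+* ℂ => s.comp (iK c j) = τc c ∧ s ∈ (Ψ c j t).1).card = 2) ∨
      (nJ c j = 5 ∧ (Finset.univ.filter fun s : KJ c j →+* ℂ => s.comp (iK c j) = τc c ∧ s ∈ (Ψ c j t).1).card = 2))
    (hni : ∀ c j (t t' : Fin (cJ c j)), t ≠ t' → ¬ AbelianVariety.IsIsogenous (B c j t) (B c j t'))
    (hone : ∀ c j, nJ c j = 4 → ¬ tJ c j → cJ c j ≤ 1 ∧ ∀ t, (Finset.univ.filter fun s : KJ c j →+* ℂ => s.comp (iK c j) = τc c ∧ s ∈ (Ψ c j t).1).card = 1)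
    (hc3 : ∀ c j, nJ c j = 3 → cJ c j ≤ 2) (hc4 : ∀ c j, nJ c j = 4 → cJ c j ≤ 3) (hc5 : ∀ c j, nJ c j = 5 → cJ c j ≤ 4)
    (hsep : ∀ c j, nJ c j = 4 → ∀ t₁ t₂ t₃ : Fin (cJ c j), t₁ ≠ t₂ → (Finset.univ.filter fun u : KJ c j →+* ℂ => u.comp (iK c j) = τc c ∧ u ∈ (Ψ c j t₁).1).card = 1 →
      (Finset.univ.filter fun u : KJ c j →+* ℂ => u.comp (iK c j) = τc c ∧ u ∈ (Ψ c j t₂).1).card = 1 →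
      (Finset.univ.filter fun u : KJ c j →+* ℂ => u.comp (iK c j) = τc c ∧ u ∈ (Ψ c j t₃).1).card = 2 →
      ∀ s₁ s₂ : KJ c j →+* ℂ, s₁.comp (iK c j) = τc c → s₂.comp (iK c j) = τc c → s₁ ∈ (Ψ c j t₁).1 → s₂ ∈ (Ψ c j t₂).1 → (s₁ ∈ (Ψ c j t₃).1 ↔ s₂ ∉ (Ψ c j t₃).1))
    (hmeet : ∀ c j, nJ c j = 5 → cJ c j = 4 → ∀ t : Fin (cJ c j), ∃ t', t' ≠ t ∧ ∃ s : KJ c j →+* ℂ, s.comp (iK c j) = τc c ∧ s ∈ (Ψ c j t).1 ∧ s ∈ (Ψ c j t').1)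
    (hodd : ∀ c j, nJ c j = 5 → cJ c j = 4 → ∃ s : KJ c j →+* ℂ, s.comp (iK c j) = τc c ∧ (Finset.univ.filter fun t : Fin (cJ c j) => s ∈ (Ψ c j t).1).card ≠ 0 ∧
      (Finset.univ.filter fun t : Fin (cJ c j) => s ∈ (Ψ c j t).1).card ≠ 2)
    (h24 : ∀ c j, nJ c j = 4 → tJ c j → ∃ s₀ t₀ : KJ c j →+* ℂ, s₀.comp (iK c j) = τc c ∧ t₀.comp (iK c j) = τc c ∧ s₀ ≠ t₀ ∧
      Module.finrank ℚ ↥(adjoin ℚ (Set.range (τc c)) ⊔ adjoin ℚ (Set.range s₀ ∪ Set.range t₀)) = 24)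
    (h40 : ∀ c j, nJ c j = 5 → 1 < cJ c j → ∃ s₀ t₀ : KJ c j →+* ℂ, s₀.comp (iK c j) = τc c ∧ t₀.comp (iK c j) = τc c ∧ s₀ ≠ t₀ ∧
      Module.finrank ℚ ↥(adjoin ℚ (Set.range (τc c)) ⊔ adjoin ℚ (Set.range s₀ ∪ Set.range t₀)) = 40)
    (hiso : ∀ c (j j' : J c), j' ≠ j → nJ c j = nJ c j' → (nJ c j' = 4 → tJ c j' ∧ tJ c j) → IsEmpty (KJ c j' →+* KJ c j))
    (hout4 : ∀ c (j j' : J c), j' ≠ j → nJ c j = 4 → (nJ c j' = 3 ∨ (nJ c j' = 4 ∧ tJ c j' ∧ ¬ tJ c j)) → ∃ s : KJ c j' →+* ℂ, s.comp (iK c j') = τc c ∧ ∃ x, s x ∉ normalClosure ℚ (KJ c j) ℂ)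
    (hdisj : ∀ c (j j' : J c), j' ≠ j → nJ c j' = 4 → ¬ tJ c j' → ∃ s : KJ c j' →+* ℂ, s.comp (iK c j') = τc c ∧
      Module.finrank ℚ ↥(normalClosure ℚ (KJ c j) ℂ ⊔ adjoin ℚ (Set.range s)) = Module.finrank ℚ ↥(normalClosure ℚ (KJ c j) ℂ) * 4)
    (hreal : ∀ (c : C) (x : ℂ), x ∈ normalClosure ℚ (kc c) ℂ ⊔ (⨆ j : J c, normalClosure ℚ (KJ c j) ℂ) →
      x ∈ (⨆ c' : {c' : C // c' ≠ c}, normalClosure ℚ (kc c'.1) ℂ ⊔ (⨆ j : J c'.1, normalClosure ℚ (KJ c'.1 j) ℂ)) → starRingEnd ℂ x = x)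
    {N : ℕ} (π : Fin N → (c : C) × Option ((j : J c) × Fin (cJ c j))) :
    HodgeConjectureFor (⨁ fun l => ((π l).2.elim (Ec (π l).1) fun y => B (π l).1 y.1 y.2 : AbelianVariety ℂ)).dim
      (⨁ fun l => ((π l).2.elim (Ec (π l).1) fun y => B (π l).1 y.1 y.2 : AbelianVariety ℂ)).X := by
  -- the uniform family over the labels
  let I : Type := (c : C) × Option ((j : J c) × Fin (cJ c j))
  let Kc : ∀ c : C, Option ((j : J c) × Fin (cJ c j)) → Type := fun c o => o.elim (kc c) fun y => KJ c y.1
  letI instFc : ∀ (c : C) (o : Option ((j : J c) × Fin (cJ c j))), Field (Kc c o) := fun c o =>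
    @Option.rec ((j : J c) × Fin (cJ c j)) (fun o => Field (Option.elim o (kc c) fun y => KJ c y.1)) (fk c) (fun y => fK c y.1) o
  letI instNc : ∀ (c : C) (o : Option ((j : J c) × Fin (cJ c j))), NumberField (Kc c o) := fun c o =>
    @Option.rec ((j : J c) × Fin (cJ c j)) (fun o => NumberField (Option.elim o (kc c) fun y => KJ c y.1)) (nk c) (fun y => nK c y.1) o
  haveI instCc : ∀ (c : C) (o : Option ((j : J c) × Fin (cJ c j))), IsCMField (Kc c o) := fun c o =>
    @Option.rec ((j : J c) × Fin (cJ c j)) (fun o => IsCMField (Option.elim o (kc c) fun y => KJ c y.1)) (ck c) (fun y => cK c y.1) o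
  let K : I → Type := fun i => Kc i.1 i.2
  letI instF : ∀ i : I, Field (K i) := fun i => instFc i.1 i.2
  letI instN : ∀ i : I, NumberField (K i) := fun i => instNc i.1 i.2
  haveI instC : ∀ i : I, IsCMField (K i) := fun i => instCc i.1 i.2
  let X : I → AbelianVariety ℂ := fun i => i.2.elim (Ec i.1) fun y => B i.1 y.1 y.2
  let ΦI : ∀ i : I, CMType (K i) := fun i => match i with
    | ⟨c, none⟩ => Φ₀ c
    | ⟨c, some y⟩ => Ψ c y.1 y.2
  let ιI : ∀ i : I, 𝓞 (K i) →+* End (X i) := fun i => match i with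
    | ⟨c, none⟩ => ιE c
    | ⟨c, some y⟩ => ιB c y.1 y.2
  let θI : ∀ i : I, K i →+* Module.End ℂ (complexBetti (X i).X 1) := fun i => match i with
    | ⟨c, none⟩ => θE c
    | ⟨c, some y⟩ => θB c y.1 y.2
  have hXI : ∀ i : I, IsCMTypeRealisation (ΦI i) (X i) (ιI i) (θI i) := by
    rintro ⟨c, _ | y⟩
    exacts [hE c, hB c y.1 y.2]
  haveI : Nonempty I := ⟨⟨Classical.arbitrary C, none⟩⟩
  -- the closure composita of a label and of the other labels are bounded by the displayed ones
  have hle : ∀ c : C, (⨆ i : {i : I // i.1 = c}, normalClosure ℚ (K i.1) ℂ) ≤ normalClosure ℚ (kc c) ℂ ⊔ ⨆ j : J c, normalClosure ℚ (KJ c j) ℂ := by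
    intro c
    refine iSup_le fun i => ?_
    obtain ⟨⟨c', o⟩, hc'⟩ := i
    dsimp only at hc'
    subst hc'
    rcases o with _ | y
    · exact le_sup_left
    · exact le_sup_of_le_right (le_iSup (fun j : J c' => normalClosure ℚ (KJ c' j) ℂ) y.1)
  have hle' : ∀ c : C, (⨆ i : {i : I // i.1 ≠ c}, normalClosure ℚ (K i.1) ℂ) ≤
      ⨆ c' : {c' : C // c' ≠ c}, normalClosure ℚ (kc c'.1) ℂ ⊔ ⨆ j : J c'.1, normalClosure ℚ (KJ c'.1 j) ℂ := by
    intro c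
    refine iSup_le fun i => ?_
    obtain ⟨⟨c', o⟩, hc'⟩ := i
    refine le_trans ?_ (le_iSup (fun c'' : {c'' : C // c'' ≠ c} => normalClosure ℚ (kc c''.1) ℂ ⊔ ⨆ j : J c''.1, normalClosure ℚ (KJ c''.1 j) ℂ) ⟨c', hc'⟩)
    rcases o with _ | y
    · exact le_sup_left
    · exact le_sup_of_le_right (le_iSup (fun j : J c' => normalClosure ℚ (KJ c' j) ℂ) y.1)
  -- inside one label: G6
  have hX : ∀ (c : C) (i : I) (h : i.1 = c), X i = ((h ▸ i.2 : Option ((j : J c) × Fin (cJ c j))).elim (Ec c) fun y => B c y.1 y.2 : AbelianVariety ℂ) := by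
    rintro c ⟨c', o⟩ h
    dsimp only at h
    subst h
    rfl
  refine hodgeConjectureFor_prod_of_foreign_blocks_of_conj_apply_eq (K := K) (A := X) hXI (fun i : I => i.1) (fun c x hx hx' => hreal c x (hle c hx) (hle' c hx'))
    (fun c M ρ hρc => ?_) π
  have hfam : (fun l => X (ρ l)) = fun l => (((hρc l) ▸ (ρ l).2 : Option ((j : J c) × Fin (cJ c j))).elim (Ec c) fun y => B c y.1 y.2 : AbelianVariety ℂ) :=
    funext fun l => hX c (ρ l) (hρc l)
  rw [hfam]
  exact hodgeConjectureFor_biproduct_sigma_imprimitive_of_shapes hW4 hM6 (h2 c) (iK c) (nJ c) (hdeg c) (hB c) (hE c) (hΦ₀ c) (tJ c) (hS c) (hcnt c) (hni c) (hone c)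
    (hc3 c) (hc4 c) (hc5 c) (hsep c) (hmeet c) (hodd c) (h24 c) (h40 c) (hiso c) (hout4 c) (hdisj c) _

/-- **Blocks whose closure composita meet in `ℚ`** (the simplest foreignness test). [cite: Lang2002, VI §1 Thm. 1.14] [cite: Markman2025SurveySecant, Thm. 1.2] [cite: Markman2025SecantWeil, Thm 1.5.1] -/
theorem hodgeConjectureFor_biproduct_sigma_blocks_of_shapes_of_inf_eq_bot (hW4 : Markman2025_weilClasses_algebraic_abelianFourfold)
    (hM6 : Markman2025_weilClasses_algebraic_hyperbolicSixfold) (h2 : ∀ c, Module.finrank ℚ (kc c) = 2) (iK : ∀ c (j : J c), kc c →+* KJ c j)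
    (nJ : ∀ c, J c → ℕ)
    (hdeg : ∀ c j, Module.finrank ℚ (KJ c j) = 2 * nJ c j) (hB : ∀ c j t, IsCMTypeRealisation (Ψ c j t) (B c j t) (ιB c j t) (θB c j t))
    (hE : ∀ c, IsCMTypeRealisation (Φ₀ c) (Ec c) (ιE c) (θE c)) (hΦ₀ : ∀ c (σ : kc c →+* ℂ), σ ∈ (Φ₀ c).1 ↔ σ = τc c) (tJ : ∀ c, J c → Prop)
    (hS : ∀ c j, nJ c j = 3 → ∀ t, (B c j t).IsSimple)
    (hcnt : ∀ c j t, (nJ c j = 3 ∧ (Finset.univ.filter fun s : KJ c j →+* ℂ => s.comp (iK c j) = τc c ∧ s ∈ (Ψ c j t).1).card = 1) ∨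
      (nJ c j = 4 ∧ (Finset.univ.filter fun s : KJ c j →+* ℂ => s.comp (iK c j) = τc c ∧ s ∈ (Ψ c j t).1).card = 1) ∨
      (nJ c j = 4 ∧ (Finset.univ.filter fun s : KJ c j →+* ℂ => s.comp (iK c j) = τc c ∧ s ∈ (Ψ c j t).1).card = 2) ∨
      (nJ c j = 5 ∧ (Finset.univ.filter fun s : KJ c j →+* ℂ => s.comp (iK c j) = τc c ∧ s ∈ (Ψ c j t).1).card = 2))
    (hni : ∀ c j (t t' : Fin (cJ c j)), t ≠ t' → ¬ AbelianVariety.IsIsogenous (B c j t) (B c j t'))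
    (hone : ∀ c j, nJ c j = 4 → ¬ tJ c j → cJ c j ≤ 1 ∧ ∀ t, (Finset.univ.filter fun s : KJ c j →+* ℂ => s.comp (iK c j) = τc c ∧ s ∈ (Ψ c j t).1).card = 1)
    (hc3 : ∀ c j, nJ c j = 3 → cJ c j ≤ 2) (hc4 : ∀ c j, nJ c j = 4 → cJ c j ≤ 3) (hc5 : ∀ c j, nJ c j = 5 → cJ c j ≤ 4)
    (hsep : ∀ c j, nJ c j = 4 → ∀ t₁ t₂ t₃ : Fin (cJ c j), t₁ ≠ t₂ → (Finset.univ.filter fun u : KJ c j →+* ℂ => u.comp (iK c j) = τc c ∧ u ∈ (Ψ c j t₁).1).card = 1 →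
      (Finset.univ.filter fun u : KJ c j →+* ℂ => u.comp (iK c j) = τc c ∧ u ∈ (Ψ c j t₂).1).card = 1 →
      (Finset.univ.filter fun u : KJ c j →+* ℂ => u.comp (iK c j) = τc c ∧ u ∈ (Ψ c j t₃).1).card = 2 →
      ∀ s₁ s₂ : KJ c j →+* ℂ, s₁.comp (iK c j) = τc c → s₂.comp (iK c j) = τc c → s₁ ∈ (Ψ c j t₁).1 → s₂ ∈ (Ψ c j t₂).1 → (s₁ ∈ (Ψ c j t₃).1 ↔ s₂ ∉ (Ψ c j t₃).1))
    (hmeet : ∀ c j, nJ c j = 5 → cJ c j = 4 → ∀ t : Fin (cJ c j), ∃ t', t' ≠ t ∧ ∃ s : KJ c j →+* ℂ, s.comp (iK c j) = τc c ∧ s ∈ (Ψ c j t).1 ∧ s ∈ (Ψ c j t').1)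
    (hodd : ∀ c j, nJ c j = 5 → cJ c j = 4 → ∃ s : KJ c j →+* ℂ, s.comp (iK c j) = τc c ∧ (Finset.univ.filter fun t : Fin (cJ c j) => s ∈ (Ψ c j t).1).card ≠ 0 ∧
      (Finset.univ.filter fun t : Fin (cJ c j) => s ∈ (Ψ c j t).1).card ≠ 2)
    (h24 : ∀ c j, nJ c j = 4 → tJ c j → ∃ s₀ t₀ : KJ c j →+* ℂ, s₀.comp (iK c j) = τc c ∧ t₀.comp (iK c j) = τc c ∧ s₀ ≠ t₀ ∧
      Module.finrank ℚ ↥(adjoin ℚ (Set.range (τc c)) ⊔ adjoin ℚ (Set.range s₀ ∪ Set.range t₀)) = 24)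
    (h40 : ∀ c j, nJ c j = 5 → 1 < cJ c j → ∃ s₀ t₀ : KJ c j →+* ℂ, s₀.comp (iK c j) = τc c ∧ t₀.comp (iK c j) = τc c ∧ s₀ ≠ t₀ ∧
      Module.finrank ℚ ↥(adjoin ℚ (Set.range (τc c)) ⊔ adjoin ℚ (Set.range s₀ ∪ Set.range t₀)) = 40)
    (hiso : ∀ c (j j' : J c), j' ≠ j → nJ c j = nJ c j' → (nJ c j' = 4 → tJ c j' ∧ tJ c j) → IsEmpty (KJ c j' →+* KJ c j))
    (hout4 : ∀ c (j j' : J c), j' ≠ j → nJ c j = 4 → (nJ c j' = 3 ∨ (nJ c j' = 4 ∧ tJ c j' ∧ ¬ tJ c j)) → ∃ s : KJ c j' →+* ℂ, s.comp (iK c j') = τc c ∧ ∃ x, s x ∉ normalClosure ℚ (KJ c j) ℂ)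
    (hdisj : ∀ c (j j' : J c), j' ≠ j → nJ c j' = 4 → ¬ tJ c j' → ∃ s : KJ c j' →+* ℂ, s.comp (iK c j') = τc c ∧
      Module.finrank ℚ ↥(normalClosure ℚ (KJ c j) ℂ ⊔ adjoin ℚ (Set.range s)) = Module.finrank ℚ ↥(normalClosure ℚ (KJ c j) ℂ) * 4)
    (hinf : ∀ c : C, (normalClosure ℚ (kc c) ℂ ⊔ (⨆ j : J c, normalClosure ℚ (KJ c j) ℂ)) ⊓
      (⨆ c' : {c' : C // c' ≠ c}, normalClosure ℚ (kc c'.1) ℂ ⊔ (⨆ j : J c'.1, normalClosure ℚ (KJ c'.1 j) ℂ)) = ⊥)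
    {N : ℕ} (π : Fin N → (c : C) × Option ((j : J c) × Fin (cJ c j))) :
    HodgeConjectureFor (⨁ fun l => ((π l).2.elim (Ec (π l).1) fun y => B (π l).1 y.1 y.2 : AbelianVariety ℂ)).dim
      (⨁ fun l => ((π l).2.elim (Ec (π l).1) fun y => B (π l).1 y.1 y.2 : AbelianVariety ℂ)).X := by
  refine hodgeConjectureFor_biproduct_sigma_blocks_of_shapes hW4 hM6 h2 iK nJ hdeg hB hE hΦ₀ tJ hS hcnt hni hone hc3 hc4 hc5 hsep hmeet hodd h24 h40 hiso hout4 hdisj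
    (fun c x h₁ h₂ => ?_) π
  have hx : x ∈ (⊥ : IntermediateField ℚ ℂ) := by
    rw [← hinf c]
    exact ⟨h₁, h₂⟩
  rw [IntermediateField.mem_bot] at hx
  obtain ⟨q, rfl⟩ := hx
  rw [eq_ratCast]
  exact map_ratCast (starRingEnd ℂ) q

/-- **Dominated and isogeny-closed form**: every product of complex abelian varieties each ISOGENOUS to some `Ec c` or some `B c j t`, and everything dominated by such a product
(isogeny factors). [cite: Markman2025SurveySecant, Thm. 1.2] [cite: Markman2025SecantWeil, Thm 1.5.1] [cite: MumfordAV1970, §19] -/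
theorem hodgeConjectureFor_of_avDominatedBy_biproduct_of_isIsogenous_blocks_of_shapes (hW4 : Markman2025_weilClasses_algebraic_abelianFourfold)
    (hM6 : Markman2025_weilClasses_algebraic_hyperbolicSixfold) (h2 : ∀ c, Module.finrank ℚ (kc c) = 2) (iK : ∀ c (j : J c), kc c →+* KJ c j)
    (nJ : ∀ c, J c → ℕ)
    (hdeg : ∀ c j, Module.finrank ℚ (KJ c j) = 2 * nJ c j) (hB : ∀ c j t, IsCMTypeRealisation (Ψ c j t) (B c j t) (ιB c j t) (θB c j t))
    (hE : ∀ c, IsCMTypeRealisation (Φ₀ c) (Ec c) (ιE c) (θE c)) (hΦ₀ : ∀ c (σ : kc c →+* ℂ), σ ∈ (Φ₀ c).1 ↔ σ = τc c) (tJ : ∀ c, J c → Prop)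
    (hS : ∀ c j, nJ c j = 3 → ∀ t, (B c j t).IsSimple)
    (hcnt : ∀ c j t, (nJ c j = 3 ∧ (Finset.univ.filter fun s : KJ c j →+* ℂ => s.comp (iK c j) = τc c ∧ s ∈ (Ψ c j t).1).card = 1) ∨
      (nJ c j = 4 ∧ (Finset.univ.filter fun s : KJ c j →+* ℂ => s.comp (iK c j) = τc c ∧ s ∈ (Ψ c j t).1).card = 1) ∨
      (nJ c j = 4 ∧ (Finset.univ.filter fun s : KJ c j →+* ℂ => s.comp (iK c j) = τc c ∧ s ∈ (Ψ c j t).1).card = 2) ∨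
      (nJ c j = 5 ∧ (Finset.univ.filter fun s : KJ c j →+* ℂ => s.comp (iK c j) = τc c ∧ s ∈ (Ψ c j t).1).card = 2))
    (hni : ∀ c j (t t' : Fin (cJ c j)), t ≠ t' → ¬ AbelianVariety.IsIsogenous (B c j t) (B c j t'))
    (hone : ∀ c j, nJ c j = 4 → ¬ tJ c j → cJ c j ≤ 1 ∧ ∀ t, (Finset.univ.filter fun s : KJ c j →+* ℂ => s.comp (iK c j) = τc c ∧ s ∈ (Ψ c j t).1).card = 1)
    (hc3 : ∀ c j, nJ c j = 3 → cJ c j ≤ 2) (hc4 : ∀ c j, nJ c j = 4 → cJ c j ≤ 3) (hc5 : ∀ c j, nJ c j = 5 → cJ c j ≤ 4)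
    (hsep : ∀ c j, nJ c j = 4 → ∀ t₁ t₂ t₃ : Fin (cJ c j), t₁ ≠ t₂ → (Finset.univ.filter fun u : KJ c j →+* ℂ => u.comp (iK c j) = τc c ∧ u ∈ (Ψ c j t₁).1).card = 1 →
      (Finset.univ.filter fun u : KJ c j →+* ℂ => u.comp (iK c j) = τc c ∧ u ∈ (Ψ c j t₂).1).card = 1 →
      (Finset.univ.filter fun u : KJ c j →+* ℂ => u.comp (iK c j) = τc c ∧ u ∈ (Ψ c j t₃).1).card = 2 →
      ∀ s₁ s₂ : KJ c j →+* ℂ, s₁.comp (iK c j) = τc c → s₂.comp (iK c j) = τc c → s₁ ∈ (Ψ c j t₁).1 → s₂ ∈ (Ψ c j t₂).1 → (s₁ ∈ (Ψ c j t₃).1 ↔ s₂ ∉ (Ψ c j t₃).1))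
    (hmeet : ∀ c j, nJ c j = 5 → cJ c j = 4 → ∀ t : Fin (cJ c j), ∃ t', t' ≠ t ∧ ∃ s : KJ c j →+* ℂ, s.comp (iK c j) = τc c ∧ s ∈ (Ψ c j t).1 ∧ s ∈ (Ψ c j t').1)
    (hodd : ∀ c j, nJ c j = 5 → cJ c j = 4 → ∃ s : KJ c j →+* ℂ, s.comp (iK c j) = τc c ∧ (Finset.univ.filter fun t : Fin (cJ c j) => s ∈ (Ψ c j t).1).card ≠ 0 ∧
      (Finset.univ.filter fun t : Fin (cJ c j) => s ∈ (Ψ c j t).1).card ≠ 2)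
    (h24 : ∀ c j, nJ c j = 4 → tJ c j → ∃ s₀ t₀ : KJ c j →+* ℂ, s₀.comp (iK c j) = τc c ∧ t₀.comp (iK c j) = τc c ∧ s₀ ≠ t₀ ∧
      Module.finrank ℚ ↥(adjoin ℚ (Set.range (τc c)) ⊔ adjoin ℚ (Set.range s₀ ∪ Set.range t₀)) = 24)
    (h40 : ∀ c j, nJ c j = 5 → 1 < cJ c j → ∃ s₀ t₀ : KJ c j →+* ℂ, s₀.comp (iK c j) = τc c ∧ t₀.comp (iK c j) = τc c ∧ s₀ ≠ t₀ ∧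
      Module.finrank ℚ ↥(adjoin ℚ (Set.range (τc c)) ⊔ adjoin ℚ (Set.range s₀ ∪ Set.range t₀)) = 40)
    (hiso : ∀ c (j j' : J c), j' ≠ j → nJ c j = nJ c j' → (nJ c j' = 4 → tJ c j' ∧ tJ c j) → IsEmpty (KJ c j' →+* KJ c j))
    (hout4 : ∀ c (j j' : J c), j' ≠ j → nJ c j = 4 → (nJ c j' = 3 ∨ (nJ c j' = 4 ∧ tJ c j' ∧ ¬ tJ c j)) → ∃ s : KJ c j' →+* ℂ, s.comp (iK c j') = τc c ∧ ∃ x, s x ∉ normalClosure ℚ (KJ c j) ℂ)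
    (hdisj : ∀ c (j j' : J c), j' ≠ j → nJ c j' = 4 → ¬ tJ c j' → ∃ s : KJ c j' →+* ℂ, s.comp (iK c j') = τc c ∧
      Module.finrank ℚ ↥(normalClosure ℚ (KJ c j) ℂ ⊔ adjoin ℚ (Set.range s)) = Module.finrank ℚ ↥(normalClosure ℚ (KJ c j) ℂ) * 4)
    (hreal : ∀ (c : C) (x : ℂ), x ∈ normalClosure ℚ (kc c) ℂ ⊔ (⨆ j : J c, normalClosure ℚ (KJ c j) ℂ) →
      x ∈ (⨆ c' : {c' : C // c' ≠ c}, normalClosure ℚ (kc c'.1) ℂ ⊔ (⨆ j : J c'.1, normalClosure ℚ (KJ c'.1 j) ℂ)) → starRingEnd ℂ x = x)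
    {N : ℕ} (X : Fin N → AbelianVariety ℂ)
    (hX : ∀ l, ∃ i : (c : C) × Option ((j : J c) × Fin (cJ c j)), AbelianVariety.IsIsogenous (X l) (i.2.elim (Ec i.1) fun y => B i.1 y.1 y.2))
    {Y : AbelianVariety ℂ} (hY : Domination.AVDominatedBy Y (⨁ X)) : HodgeConjectureFor Y.dim Y.X := by
  choose π hπ using hX
  refine Domination.hodgeConjectureFor_of_avDominatedBy ?_ hY
  exact Domination.hodgeConjectureFor_of_avDominatedBy
    (hodgeConjectureFor_biproduct_sigma_blocks_of_shapes hW4 hM6 h2 iK nJ hdeg hB hE hΦ₀ tJ hS hcnt hni hone hc3 hc4 hc5 hsep hmeet hodd h24 h40 hiso hout4 hdisj hreal π)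
    (Domination.AVDominatedBy.of_isIsogenous (AbelianVariety.IsIsogenous.biproduct hπ) (Domination.AVDominatedBy.refl _))

end Blocks

end Summit.HodgeConjecture.CorCM.MultiFieldWeil

end
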